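import Summits.NavierStokesRegularity.NavierStokesRegularity.Theorems.TypeICertificateLadderTypeIConcentrationBP
import Summits.NavierStokesRegularity.NavierStokesRegularity.Theorems.StretchingWellBindingEnstrophyQuarterLawSparseSieveDefs
import HarnessLib

/-!
# Shelf crux `EnstrophyQuarterLaw` (stmt-NavierStokesRegularity-1574), line «sparse_sieve»:
# Barker–Prange `L³` concentration at EVERY singular point of the first blow-up slice, one onset time

Helper file (`--supports stmt-NavierStokesRegularity-1574`; closes no registered stub; route-independent: no
`Theses` import). Tools for the sibling file `…EnstrophyQuarterLawFiniteSingularSet.lean`, which proves that the two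
open velocity-side stubs S1 (`UniformLocalTypeI`) and S2 (`UniformSparseness`) of `Lines/sparse_sieve.lean` force
finitely many singular points at the blow-up time.

* `bp_concentration_at_every_singularPoint` — Barker–Prange 2020, Thm. 2 (PROVED in the tree,
  `BarkerPrange2020_thm2_holds`) packaged for classical Leray–Hopf solutions on `[0, T)` from rapidly decaying
  data under an eventual Morrey-type bound `∫_{B_r(y)} |u(t)|² ≤ M² ν² r` (`r ≤ r₁`): there are a universal
  `γ > 0`, a radius factor `ρ = ρ(M)` and ONE onset time `t₁ < T` such that EVERY singular point `x₀` of the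
  time-`T` slice (essential unboundedness on all backward cylinders `(T - r², T) × B_r(x₀)`) carries
  `γ ν³ ≤ ∫_{B(x₀, ρ√(ν(T-t)))} |u(t)|³` for all `t ∈ (t₁, T)`. (The packaging `bp_concentration_of_morrey` of
  `TypeICertificateLadderTypeIConcentrationBP.lean` produces one point; the onset time `t_*(T*, M, r₀)` of the
  printed theorem does not depend on the point, which is what a COUNT of singular points needs.)
* `morrey_of_uniformLocalTypeI` — clause (A) of S1 is exactly such a Morrey bound (`M² ν² = M_A`).
* `exists_pos_le_dist_of_finset` — a finite set of points is `δ`-separated for some `δ > 0`.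

HONEST FRAMING: statements about hypothetical blow-ups; no registered stub is closed; `EnstrophyQuarterLaw`
(1574) stays OPEN; nothing here proves Navier–Stokes regularity.
-/

noncomputable section

-- the summit and its single sub-problem share the name (CONVENTIONS §1), as in every Theorems file
set_option linter.dupNamespace false

namespace Summit.NavierStokesRegularity.NavierStokesRegularity.Theorems.EnstrophyQuarterLaw.SparseSieve.FiniteSingularSet

open MeasureTheory Set Function Filter Topology TopologicalSpace Metric
open Literature.Analysis.FluidPDE
open scoped NNReal ENNReal

/-- **Barker–Prange concentration at EVERY singular point, with ONE onset time.** There is `γ > 0` (the cube of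
Barker–Prange's universal `γ_univ`) and for every `M > 0` a radius factor `ρ = 2/√(S*(M)) > 0` such that: for
`ν > 0`, `T > 0` and a classical solution `(u, p)` of the unforced Navier–Stokes system on `ℝ³ × [0, T)`,
Leray–Hopf from its rapidly decaying datum, satisfying eventually as `t ↑ T` the Morrey-type bound
`∫_{B_r(y)} ‖u(t)‖² ≤ M² ν² r` for all `y` and `0 < r ≤ r₁` (some `r₁ > 0`), there is an onset time
`t₁ ∈ [0, T)` such that every point `x₀` at which `u` is essentially unbounded on all backward cylinders
`(T - r², T) × B_r(x₀)` (`0 < r`, `r² < T`) satisfies `γ ν³ ≤ ∫_{B(x₀, ρ√(ν(T-t)))} ‖u(t)‖³` for all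
`t ∈ (t₁, T)`. Proof: Barker–Prange 2020 Thm. 2 (`BarkerPrange2020_thm2_holds`, whose `t_*` depends on
`(T, M, r₀)` only) applied to Leray's global weak continuation of `u` (`leray_existence_R3_holds`), equal to `u`
a.e. on every slice of `(0, T)` by weak–strong uniqueness; regularity of the open strip and the singular points are
transferred along the a.e. equality exactly as in `bp_concentration_of_morrey`.
[cite: BarkerPrange2020, Thm. 2 (arXiv:1812.09115 pp. 4–5, `t_*(T*, M, r₀)`)] -/
theorem bp_concentration_at_every_singularPoint :
    ∃ γ : ℝ, 0 < γ ∧ ∀ M : ℝ, 0 < M → ∃ ρ : ℝ, 0 < ρ ∧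
      ∀ (ν T : ℝ), 0 < ν → 0 < T →
        ∀ (u : ℝ → EuclideanSpace ℝ (Fin 3) → EuclideanSpace ℝ (Fin 3))
          (p : ℝ → EuclideanSpace ℝ (Fin 3) → ℝ),
          IsClassicalNSSolutionOn (Ico 0 T) ν 0 u p → IsLerayHopfOn T ν 0 (u 0) u →
          HasRapidSpatialDecay (u 0) →
          (∃ r₁ : ℝ, 0 < r₁ ∧ ∀ᶠ t in 𝓝[<] T, ∀ (y : EuclideanSpace ℝ (Fin 3)) (r : ℝ),
              0 < r → r ≤ r₁ → ∫ x in ball y r, ‖u t x‖ ^ 2 ≤ M ^ 2 * ν ^ 2 * r) →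
          ∃ t₁ : ℝ, 0 ≤ t₁ ∧ t₁ < T ∧ ∀ x₀ : EuclideanSpace ℝ (Fin 3),
            (∀ r : ℝ, 0 < r → r ^ 2 < T →
              eLpNorm (uncurry u) ∞ (volume.restrict (parabolicCylinder r ((T : ℝ), x₀))) = ∞) →
            ∀ t ∈ Ioo t₁ T,
              γ * ν ^ 3 ≤ ∫ x in ball x₀ (ρ * Real.sqrt (ν * (T - t))), ‖u t x‖ ^ 3 := by
  obtain ⟨γ₀, hγ₀, hBP⟩ := BarkerPrange2020_thm2_holds
  refine ⟨γ₀ ^ 3, by positivity, fun M hM => ?_⟩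
  obtain ⟨S, hS, -, hBPM⟩ := hBP M hM
  refine ⟨2 / Real.sqrt S, by positivity, ?_⟩
  intro ν T hν hT u p hcl hLH hdec hmor
  obtain ⟨r₁, hr₁, hmor⟩ := hmor
  -- the eventual range `(t₁, T)` of the Morrey bound, `0 ≤ t₁`
  obtain ⟨t₁', ht₁'T, ht₁'⟩ := mem_nhdsLT_iff_exists_Ioo_subset.1 hmor
  set t₁ : ℝ := max t₁' 0 with ht₁def
  have ht₁T : t₁ < T := max_lt ht₁'T hT
  have ht₁0 : 0 ≤ t₁ := le_max_right _ _
  have hmorr : ∀ t ∈ Ioo t₁ T, ∀ (y : EuclideanSpace ℝ (Fin 3)) (r : ℝ), 0 < r → r ≤ r₁ →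
      ∫ x in ball y r, ‖u t x‖ ^ 2 ≤ M ^ 2 * ν ^ 2 * r := fun t ht =>
    ht₁' ⟨lt_of_le_of_lt (le_max_left _ _) ht.1, ht.2⟩
  -- the radius bound `r₀` of Barker–Prange
  set r₀ : ℝ := min r₁ (Real.sqrt (ν * (T - t₁))) / 2 with hr₀def
  have hνT : 0 < ν * (T - t₁) := mul_pos hν (sub_pos.2 ht₁T)
  have hr₀pos : 0 < r₀ := by
    have : 0 < min r₁ (Real.sqrt (ν * (T - t₁))) := lt_min hr₁ (Real.sqrt_pos.2 hνT)
    rw [hr₀def]; linarith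
  have hr₀r₁ : r₀ < r₁ := by
    have h1 : min r₁ (Real.sqrt (ν * (T - t₁))) ≤ r₁ := min_le_left _ _
    rw [hr₀def]; linarith
  have hr₀sq : r₀ ^ 2 < ν * (T - t₁) := by
    have h1 : min r₁ (Real.sqrt (ν * (T - t₁))) ≤ Real.sqrt (ν * (T - t₁)) := min_le_right _ _
    have h2 : r₀ < Real.sqrt (ν * (T - t₁)) := by
      have h3 : 0 < Real.sqrt (ν * (T - t₁)) := Real.sqrt_pos.2 hνT
      rw [hr₀def]; linarith
    calc r₀ ^ 2 < Real.sqrt (ν * (T - t₁)) ^ 2 := pow_lt_pow_left₀ h2 hr₀pos.le (by norm_num)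
      _ = ν * (T - t₁) := Real.sq_sqrt hνT.le
  obtain ⟨tStar, -, htStarT, -, hmain⟩ :=
    hBPM ν T hν hT (ENNReal.ofReal r₀) (ENNReal.ofReal_pos.2 hr₀pos)
  -- Leray's global weak continuation `v` of `u`
  have hu02 : MemLp (u 0) 2 volume := hLH.memLp 0 ⟨le_rfl, hT.le⟩
  obtain ⟨v, hv⟩ := leray_existence_R3_holds ν hν (u 0) hu02 (hLH.isWeaklyDivFree_datum hT)
  -- `v(t) = u(t)` a.e. for `0 < t < T`
  have hvu : ∀ t ∈ Ioo 0 T, v t =ᵐ[volume] u t := by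
    intro t ht
    set T' : ℝ := (t + T) / 2 with hT'def
    have htT' : t < T' := by rw [hT'def]; linarith [ht.2]
    have hT'T : T' < T := by rw [hT'def]; linarith [ht.2]
    have hT'0 : 0 < T' := ht.1.trans htT'
    obtain ⟨B, hB⟩ := exists_forall_norm_le_of_tao2011 tao2011_hasBoundedSobolevNormsOn_holds hν
      hcl hLH hdec T' ⟨hT'0, hT'T⟩
    have hSer : MemLqLp ∞ ∞ u (Ioo 0 T') :=
      memLqLp_top_top_of_bound (fun s hs =>
        (hcl.contDiff_velocity ⟨hs.1, hs.2.trans_lt hT'T⟩).continuous.aestronglyMeasurable) hB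
    exact weak_strong_uniqueness_holds hν hT'0 (hLH.of_le hT'T.le) (q := ⊤) (r := ⊤)
      ENNReal.ofNat_lt_top (by simp [ENNReal.div_top]) hSer (hv.isLerayHopfOn hT'0) t
      ⟨ht.1, htT'.le⟩
  -- measurability of `u` on the strip and the product a.e. equality
  have hum : AEStronglyMeasurable (uncurry u) (volume.restrict (Ioo 0 T ×ˢ univ)) :=
    (hcl.smooth_velocity.continuousOn.mono
      (prod_mono Ioo_subset_Ico_self Subset.rfl)).aestronglyMeasurable
      (measurableSet_Ioo.prod MeasurableSet.univ)
  have hvu_ae : uncurry v =ᵐ[volume.restrict (Ioo 0 T ×ˢ (univ : Set (EuclideanSpace ℝ (Fin 3))))]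
      uncurry u :=
    ae_restrict_prod_of_forall_ae_eq hvu (hv T hT).weak.1 hum
  -- (1.7): the Morrey-type bound for `v`
  have hMorrey : ∀ (y : EuclideanSpace ℝ (Fin 3)) (r : ℝ), 0 < r → ENNReal.ofReal r < ENNReal.ofReal r₀ →
      ∀ t : ℝ, 0 < t → T - r ^ 2 / ν < t → t < T →
        eLpNorm (v t) 2 (volume.restrict (ball y r)) ≤ ENNReal.ofReal (M * ν * Real.sqrt r) := by
    intro y r hr hrr₀ t ht0 htr htT
    have hrr₀' : r < r₀ := (ENNReal.ofReal_lt_ofReal_iff hr₀pos).1 hrr₀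
    have hrr₁ : r ≤ r₁ := (hrr₀'.trans hr₀r₁).le
    have hr2 : r ^ 2 < ν * (T - t₁) :=
      lt_of_le_of_lt (pow_le_pow_left₀ hr.le hrr₀'.le 2) hr₀sq
    have ht₁t : t₁ < t := by
      have h1 : r ^ 2 / ν < T - t₁ := by rw [div_lt_iff₀ hν]; linarith
      linarith
    have hbd := hmorr t ⟨ht₁t, htT⟩ y r hr hrr₁
    have hcont : Continuous (u t) := (hcl.contDiff_velocity ⟨ht0.le, htT⟩).continuous
    have hae : v t =ᵐ[volume.restrict (ball y r)] u t := ae_restrict_of_ae (hvu t ⟨ht0, htT⟩)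
    rw [eLpNorm_congr_ae hae, eLpNorm_eq_lintegral_rpow_enorm_toReal (by norm_num) (by norm_num),
      ENNReal.toReal_ofNat]
    have e2 : ∀ x, ‖u t x‖ₑ ^ (2 : ℝ) = ‖u t x‖ₑ ^ (2 : ℕ) := fun x => by
      rw [show (2 : ℝ) = ((2 : ℕ) : ℝ) by norm_num, ENNReal.rpow_natCast]
    simp only [e2]
    rw [typeIConc_lintegral_ball_enorm_pow_eq hcont y r 2]
    have hle : ENNReal.ofReal (∫ x in ball y r, ‖u t x‖ ^ 2) ≤
        ENNReal.ofReal ((M * ν * Real.sqrt r) ^ 2) := by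
      refine ENNReal.ofReal_le_ofReal (hbd.trans_eq ?_)
      rw [mul_pow, mul_pow, Real.sq_sqrt hr.le]
    calc (ENNReal.ofReal (∫ x in ball y r, ‖u t x‖ ^ 2)) ^ (1 / (2 : ℝ))
        ≤ (ENNReal.ofReal ((M * ν * Real.sqrt r) ^ 2)) ^ (1 / (2 : ℝ)) := by gcongr
      _ = ENNReal.ofReal (M * ν * Real.sqrt r) := by
          rw [ENNReal.ofReal_rpow_of_nonneg (by positivity) (by norm_num), ← Real.sqrt_eq_rpow,
            Real.sqrt_sq (by positivity)]
  -- every point of the open strip is regular for `v`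
  have hReg : ∀ t ∈ Ioo 0 T, ∀ x : EuclideanSpace ℝ (Fin 3), IsRegularPoint v (t, x) := by
    intro t ht x
    set r : ℝ := Real.sqrt (min t (T - t)) / 2 with hrdef
    have hmin : 0 < min t (T - t) := lt_min ht.1 (sub_pos.2 ht.2)
    have hr : 0 < r := by rw [hrdef]; positivity
    have hr2 : r ^ 2 < min t (T - t) := by
      have h1 : r ^ 2 = min t (T - t) / 4 := by
        rw [hrdef, div_pow, Real.sq_sqrt hmin.le]; norm_num
      rw [h1]; linarith
    have hr2t : r ^ 2 < t := lt_of_lt_of_le hr2 (min_le_left _ _)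
    have hr2T : t + r ^ 2 < T := by
      have := lt_of_lt_of_le hr2 (min_le_right _ _); linarith
    -- the closed box around the cylinder is compact inside `[0, T) × ℝ³`
    set K : Set (ℝ × EuclideanSpace ℝ (Fin 3)) := Icc (t - r ^ 2) (t + r ^ 2) ×ˢ closedBall x r with hKdef
    have hK : IsCompact K := isCompact_Icc.prod (isCompact_closedBall _ _)
    have hKsub : K ⊆ Ico 0 T ×ˢ (univ : Set (EuclideanSpace ℝ (Fin 3))) :=
      prod_mono (fun s hs => ⟨by linarith [hs.1], lt_of_le_of_lt hs.2 hr2T⟩) (subset_univ _)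
    have hcont : ContinuousOn (uncurry u) K := hcl.smooth_velocity.continuousOn.mono hKsub
    obtain ⟨B, hB⟩ := hK.exists_bound_of_continuousOn hcont
    have hcylK : parabolicCylinderCentered r ((t : ℝ), x) ⊆ K := by
      rintro ⟨s, y⟩ hz
      rw [mem_parabolicCylinderCentered] at hz
      exact ⟨⟨hz.1.1.le, hz.1.2.le⟩, mem_closedBall.2 hz.2.le⟩
    have hcylstrip : parabolicCylinderCentered r ((t : ℝ), x) ⊆
        Ioo 0 T ×ˢ (univ : Set (EuclideanSpace ℝ (Fin 3))) := by
      rintro ⟨s, y⟩ hz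
      rw [mem_parabolicCylinderCentered] at hz
      exact ⟨⟨by linarith [hz.1.1], by linarith [hz.1.2]⟩, mem_univ _⟩
    refine ⟨r, hr, ?_⟩
    rw [eLpNorm_exponent_top]
    refine eLpNormEssSup_lt_top_of_ae_bound (C := B) ?_
    have h1 : uncurry v =ᵐ[volume.restrict (parabolicCylinderCentered r ((t : ℝ), x))] uncurry u :=
      ae_restrict_of_ae_restrict_of_subset hcylstrip hvu_ae
    filter_upwards [h1, ae_restrict_mem (isOpen_parabolicCylinderCentered r ((t : ℝ), x)).measurableSet]
      with z hz hzmem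
    rw [hz]
    exact hB z (hcylK hzmem)
  -- ONE onset time for all singular points
  refine ⟨max tStar 0, le_max_right _ _, max_lt htStarT hT, fun x₀ hx₀ t ht => ?_⟩
  -- `(T, x₀)` is a singular point of `v`
  have hSing : ∀ r : ℝ, 0 < r → r ^ 2 < T →
      eLpNorm (uncurry v) ∞ (volume.restrict (parabolicCylinder r ((T : ℝ), x₀))) = ∞ := by
    intro r hr _
    exact eLpNorm_parabolicCylinder_eq_top_of_ae_eq hT hvu_ae x₀
      (fun r' hr' => eLpNorm_top_parabolicCylinder_eq_top_of_small hT hx₀ hr') hr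
  -- Barker–Prange, Thm. 2, at `x₀`
  have hconc := hmain (u 0) v hv hMorrey hReg x₀ hSing
  have ht0 : 0 < t := lt_of_le_of_lt (le_max_right _ _) ht.1
  have htS : tStar < t := lt_of_le_of_lt (le_max_left _ _) ht.1
  have h1 := hconc t ⟨htS, ht.2⟩
  have hcont : Continuous (u t) := (hcl.contDiff_velocity ⟨ht0.le, ht.2⟩).continuous
  -- the radius
  have hrad : 2 * Real.sqrt (ν * (T - t) / S) = 2 / Real.sqrt S * Real.sqrt (ν * (T - t)) := by
    rw [Real.sqrt_div' _ hS.le]; ring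
  set R : ℝ := 2 / Real.sqrt S * Real.sqrt (ν * (T - t)) with hRdef
  rw [hrad] at h1
  -- pass from `v` on the closed ball to `u` on the open ball
  have hae : v t =ᵐ[volume.restrict (closedBall x₀ R)] u t := ae_restrict_of_ae (hvu t ⟨ht0, ht.2⟩)
  rw [eLpNorm_congr_ae hae, Measure.restrict_congr_set (typeIConc_closedBall_ae_eq_ball x₀ R),
    eLpNorm_eq_lintegral_rpow_enorm_toReal (by norm_num) (by norm_num), ENNReal.toReal_ofNat] at h1
  have e3 : ∀ x, ‖u t x‖ₑ ^ (3 : ℝ) = ‖u t x‖ₑ ^ (3 : ℕ) := fun x => by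
    rw [show (3 : ℝ) = ((3 : ℕ) : ℝ) by norm_num, ENNReal.rpow_natCast]
  simp only [e3] at h1
  rw [typeIConc_lintegral_ball_enorm_pow_eq hcont x₀ R 3] at h1
  -- cube both sides
  have h2 : ENNReal.ofReal (γ₀ * ν) ^ (3 : ℝ) <
      ((ENNReal.ofReal (∫ x in ball x₀ R, ‖u t x‖ ^ 3)) ^ (1 / (3 : ℝ))) ^ (3 : ℝ) :=
    ENNReal.rpow_lt_rpow h1 (by norm_num)
  rw [← ENNReal.rpow_mul, one_div, inv_mul_cancel₀ (by norm_num : (3 : ℝ) ≠ 0), ENNReal.rpow_one,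
    ENNReal.ofReal_rpow_of_nonneg (by positivity) (by norm_num)] at h2
  have h3 := (ENNReal.ofReal_lt_ofReal_iff_of_nonneg (by positivity)).1 h2
  have h4 : (γ₀ * ν) ^ (3 : ℝ) = γ₀ ^ 3 * ν ^ 3 := by
    rw [show (3 : ℝ) = ((3 : ℕ) : ℝ) by norm_num, Real.rpow_natCast, mul_pow]
  rw [h4] at h3
  exact h3.le

/-- **Clause (A) of S1 is a Morrey-type Type-I bound.** `UniformLocalTypeI T u` (its first clause:
`∫⁻_{B_R(x)} ‖u(s)‖ₑ² ≤ M_A R` for `s < T`, all `x`, `0 < R ≤ r₀`) gives, for the classical solution on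
`[0, T)`, the Bochner form `∫_{B_r(y)} ‖u(t)‖² ≤ M² ν² r` with `M = √M_A / ν`, for all `0 < t < T` (hence
eventually as `t ↑ T`). [folklore] -/
theorem morrey_of_uniformLocalTypeI {ν T : ℝ} (hν : 0 < ν) (hT : 0 < T)
    {u : ℝ → EuclideanSpace ℝ (Fin 3) → EuclideanSpace ℝ (Fin 3)} {p : ℝ → EuclideanSpace ℝ (Fin 3) → ℝ}
    (hcl : IsClassicalNSSolutionOn (Ico 0 T) ν 0 u p) (hA : UniformLocalTypeI T u) :
    ∃ M : ℝ, 0 < M ∧ ∃ r₁ : ℝ, 0 < r₁ ∧ ∀ᶠ t in 𝓝[<] T, ∀ (y : EuclideanSpace ℝ (Fin 3)) (r : ℝ),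
      0 < r → r ≤ r₁ → ∫ x in ball y r, ‖u t x‖ ^ 2 ≤ M ^ 2 * ν ^ 2 * r := by
  obtain ⟨M₀, r₀, hM₀, hr₀, hAcl, -⟩ := hA
  refine ⟨Real.sqrt M₀ / ν, by positivity, r₀, hr₀, ?_⟩
  have hMeq : (Real.sqrt M₀ / ν) ^ 2 * ν ^ 2 = M₀ := by
    rw [div_pow, Real.sq_sqrt hM₀.le]; field_simp
  filter_upwards [Ioo_mem_nhdsLT hT] with t ht y r hr hrr₀
  have hcont : Continuous (u t) := (hcl.contDiff_velocity ⟨ht.1.le, ht.2⟩).continuous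
  have h1 := hAcl t ⟨ht.1.le, ht.2⟩ y r ⟨hr, hrr₀⟩
  rw [typeIConc_lintegral_ball_enorm_pow_eq hcont y r 2] at h1
  rw [hMeq]
  exact (ENNReal.ofReal_le_ofReal_iff (by positivity)).1 h1

/-- A finite set of points of a metric space is `δ`-separated for some `δ > 0`. [folklore] -/
theorem exists_pos_le_dist_of_finset {X : Type*} [MetricSpace X] (F : Finset X) :
    ∃ δ : ℝ, 0 < δ ∧ ∀ x ∈ F, ∀ y ∈ F, x ≠ y → δ ≤ dist x y := by
  by_cases hne : F.offDiag.Nonempty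
  · obtain ⟨q, hq, hmin⟩ := F.offDiag.exists_min_image (fun q => dist q.1 q.2) hne
    refine ⟨dist q.1 q.2, dist_pos.2 (Finset.mem_offDiag.1 hq).2.2, fun x hx y hy hxy => ?_⟩
    exact hmin (x, y) (Finset.mem_offDiag.2 ⟨hx, hy, hxy⟩)
  · exact ⟨1, one_pos, fun x hx y hy hxy => (hne ⟨(x, y), Finset.mem_offDiag.2 ⟨hx, hy, hxy⟩⟩).elim⟩

end Summit.NavierStokesRegularity.NavierStokesRegularity.Theorems.EnstrophyQuarterLaw.SparseSieve.FiniteSingularSet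

end
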